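/-
Origin: expansion seat `planner-pub-hodgecm-pv10-g4-0`, handover #11 2026-08-18T13:09:43Z (`HOME/pub-hodgecm-pv10-g4/lean/Pv10g4/QuotientInStages.lean`, md5 bc200121, 538 lines);
landed by the gen-8 packager in gate run 30 as `HodgeCM/PerL34/QuotientInStages.lean` (stripped 7 #print/#check/#eval lines).
-/
/-
Origin: HOME/pub-hodgecm-pv10-g4/lean/Pv10g4/QuotientInStages.lean (WIP module `Pv10g4.QuotientInStages`;
intended final place `HodgeCM/PerL34/QuotientInStages.lean` = module `HodgeCM.PerL34.QuotientInStages`)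
(NO import rewrite on landing: it imports the RUN-29-landed tree module `HodgeCM.PerL34.CongruenceLatticeTower` directly).
-/
import Mathlib.Topology.Algebra.ConstMulAction
import Mathlib.Topology.Homeomorph.Lemmas
import Summits.HodgeConjecture.HodgeCM.PerL34.CongruenceLatticeTower

/-!
# Quotients in stages: `X/Γ ≃ₜ (X/Γ₁)/(Γ/Γ₁)` and the finite deck group (PerL v5 l. 75, KERNEL)

PerL v5 §1.2, ll. 74–75: "there is a neat normal `K_1 ⊂ K_f` of finite index with `P^L_{Γ_1} → P^L_Γ` finite
étale … `P_{K_f}` is the quotient of `P_{K_1}` by the finite group `K_f/K_1`".  ANALYTICALLY each piece of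
`P_{K_f}(ℂ)` is `Γ\Y` with `Y = G_U(ℝ)/C` (`≅ 𝔹²`) and `Γ = Γ_H(gK_fg⁻¹)`, and the corresponding piece upstairs
is `Γ₁\Y`, `Γ₁ = Γ_H(gK₁g⁻¹) ⊴ Γ` of finite index (row #9).  This file proves the underlying
GROUP-ACTION statement, for ANY action:

* §1 (abstract; a group `G` acting on a type `X`, subgroups `Γ₁ ≤ Γ ≤ G` with `Γ₁ ⊴ Γ`): the orbit map
  `orbitMap : X/Γ₁ → X/Γ` (surjective); the DECK HOMOMORPHISM `deckHom : Γ →* Equiv.Perm (X/Γ₁)`,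
  `γ ↦ ([x] ↦ [γ • x])`, killing `Γ₁`; its image `D = deckHom.range` (the deck group) is FINITE when
  `[Γ : Γ₁] < ∞`, of order dividing `[Γ : Γ₁]`; the fibres of `orbitMap` are the `D`-orbits and
  **`stagesEquiv : (X/Γ₁)/D ≃ X/Γ`**; if `Γ` acts freely on `X` then `D` acts FREELY on `X/Γ₁`
  (`stabilizer_deck_eq_bot`) and `ker deckHom = Γ₁` (so `D ≃* Γ/Γ₁`, `|D| = [Γ : Γ₁]`);
* §2 (topology; `X` a topological space, all orbit spaces with the quotient topology): `orbitMap` is a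
  quotient map and **`stagesHomeomorph : (X/Γ₁)/D ≃ₜ X/Γ`** for ANY action (no continuity needed); when
  `G` acts by homeomorphisms the deck transformations are homeomorphisms (`deckHomeomorph`) and `D` acts on
  `X/Γ₁` by homeomorphisms;
* §3 (PerL): for `U(H)` the piece data are bundled in the record
  `PieceQuotientInStages L H C K₁ K_f g` (fields `le`, `normal`, `free`, `finite_deck`, `card_deck_dvd`,
  `stages : Nonempty ((Γ₁\Y)/D_g ≃ₜ Γ\Y)`, `free_deck`, `card_deck_eq`; `Γ = Γ_H(gK_fg⁻¹)`, `Γ₁ = Γ_H(gK₁g⁻¹)`,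
  `Y = U(H)(ℝ)/C`, `D_g = pieceDeckGroup …` the deck group); and for `G_U` (`V : HermSpace3`), a compact
  subgroup `C ≤ G_U(ℝ)` and a compact open `K_f`, the small normal level `K₁ ≤ K_f ∩ K_H(3)` of row #9
  satisfies the record for EVERY `g` — **`HodgeCM.HermSpace3.exists_pieces_quotient_in_stages`**: `Γ₁` acts
  freely on `Y`, `D_g` is finite of order dividing `[K_f : K₁]`, `(Γ₁\Y)/D_g ≃ₜ Γ\Y`, and `D_g` acts freely on
  `Γ₁\Y` with `|D_g| = [Γ : Γ₁]` as soon as `Γ` itself is torsion-free (e.g. `K_f ≤ K_H(3)`, row #8).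

Kernel theorems over rows #5/#9 and Mathlib only (no cited facts); `#print axioms` = the standard trio.
NOT claimed: "étale"/covering-map structure, complex structure, algebraicity.
-/

noncomputable section

open scoped Pointwise
open MulAction Topology

namespace HodgeCM.PerL34.Godement

namespace Stages

/-! ## §1  Orbit spaces in stages (abstract) -/

section Abstract

variable {G X : Type*} [Group G] [MulAction G X] {Γ₁ Γ : Subgroup G}

/-- (Ported verbatim from the HodgeCMPerL package; no docstring in the source.) -/
theorem conj_mem_of_normal_subgroupOf (hle : Γ₁ ≤ Γ) [hN : (Γ₁.subgroupOf Γ).Normal]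
    {γ : G} (hγ : γ ∈ Γ) {δ : G} (hδ : δ ∈ Γ₁) : γ * δ * γ⁻¹ ∈ Γ₁ := by
  have h := hN.conj_mem ⟨δ, hle hδ⟩ (Subgroup.mem_subgroupOf.mpr hδ) ⟨γ, hγ⟩
  exact Subgroup.mem_subgroupOf.mp h

variable (Γ₁ Γ)

/-- The orbit map `X/Γ₁ → X/Γ` for `Γ₁ ≤ Γ`. -/
def orbitMap (hle : Γ₁ ≤ Γ) : orbitRel.Quotient Γ₁ X → orbitRel.Quotient Γ X :=
  Quotient.lift (fun x : X => (Quotient.mk (orbitRel Γ X) x)) (by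
    intro a b hab
    obtain ⟨δ, rfl⟩ := mem_orbit_iff.mp (orbitRel_apply.mp hab)
    exact Quotient.sound (orbitRel_apply.mpr (mem_orbit_iff.mpr ⟨⟨δ, hle δ.2⟩, rfl⟩)))

/-- (Ported verbatim from the HodgeCMPerL package; no docstring in the source.) -/
@[simp] theorem orbitMap_mk (hle : Γ₁ ≤ Γ) (x : X) :
    orbitMap Γ₁ Γ hle (Quotient.mk (orbitRel Γ₁ X) x) = Quotient.mk (orbitRel Γ X) x := rfl

/-- (Ported verbatim from the HodgeCMPerL package; no docstring in the source.) -/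
theorem orbitMap_surjective (hle : Γ₁ ≤ Γ) : Function.Surjective (orbitMap Γ₁ Γ hle (X := X)) := by
  intro q
  induction q using Quotient.inductionOn with
  | h x => exact ⟨Quotient.mk _ x, rfl⟩

/-- Translation by an element normalising `Γ₁`, descended to `X/Γ₁`. -/
def deckFun (g : G) (hg : ∀ δ ∈ Γ₁, g * δ * g⁻¹ ∈ Γ₁) : orbitRel.Quotient Γ₁ X → orbitRel.Quotient Γ₁ X :=
  Quotient.lift (fun x : X => (Quotient.mk (orbitRel Γ₁ X) (g • x))) (by
    intro a b hab
    obtain ⟨δ, rfl⟩ := mem_orbit_iff.mp (orbitRel_apply.mp hab)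
    refine Quotient.sound (orbitRel_apply.mpr (mem_orbit_iff.mpr ⟨⟨g * δ * g⁻¹, hg δ δ.2⟩, ?_⟩))
    simp only [Subgroup.smul_def, mul_smul, inv_smul_smul])

/-- (Ported verbatim from the HodgeCMPerL package; no docstring in the source.) -/
@[simp] theorem deckFun_mk (g : G) (hg : ∀ δ ∈ Γ₁, g * δ * g⁻¹ ∈ Γ₁) (x : X) :
    deckFun Γ₁ g hg (Quotient.mk (orbitRel Γ₁ X) x) = Quotient.mk (orbitRel Γ₁ X) (g • x) := rfl

/-- **The deck homomorphism** `Γ →* Perm (X/Γ₁)`, `γ ↦ ([x] ↦ [γ • x])`, for `Γ₁ ⊴ Γ`. -/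
def deckHom (hle : Γ₁ ≤ Γ) [(Γ₁.subgroupOf Γ).Normal] : Γ →* Equiv.Perm (orbitRel.Quotient Γ₁ X) :=
  MonoidHom.mk'
    (fun γ =>
      { toFun := deckFun Γ₁ (γ : G) (fun _ hδ => conj_mem_of_normal_subgroupOf hle γ.2 hδ)
        invFun := deckFun Γ₁ ((γ : G)⁻¹) (fun _ hδ => conj_mem_of_normal_subgroupOf hle (Γ.inv_mem γ.2) hδ)
        left_inv := by
          intro q
          induction q using Quotient.inductionOn with
          | h x => simp only [deckFun_mk, inv_smul_smul]
        right_inv := by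
          intro q
          induction q using Quotient.inductionOn with
          | h x => simp only [deckFun_mk, smul_inv_smul] })
    (by
      intro γ γ'
      ext q
      induction q using Quotient.inductionOn with
      | h x => simp only [Subgroup.coe_mul, Equiv.coe_fn_mk, Equiv.Perm.coe_mul, Function.comp_apply,
          deckFun_mk, mul_smul])

/-- (Ported verbatim from the HodgeCMPerL package; no docstring in the source.) -/
@[simp] theorem deckHom_mk (hle : Γ₁ ≤ Γ) [(Γ₁.subgroupOf Γ).Normal] (γ : Γ) (x : X) :
    deckHom Γ₁ Γ hle γ (Quotient.mk (orbitRel Γ₁ X) x) = Quotient.mk (orbitRel Γ₁ X) ((γ : G) • x) := rfl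

/-- `Γ₁` acts trivially: the deck homomorphism kills `Γ₁`. -/
theorem deckHom_eq_one_of_mem (hle : Γ₁ ≤ Γ) [(Γ₁.subgroupOf Γ).Normal] (γ : Γ) (h : (γ : G) ∈ Γ₁) :
    deckHom Γ₁ Γ hle γ = (1 : Equiv.Perm (orbitRel.Quotient Γ₁ X)) := by
  ext q
  induction q using Quotient.inductionOn with
  | h x =>
    rw [deckHom_mk, Equiv.Perm.coe_one, id]
    exact Quotient.sound (orbitRel_apply.mpr (mem_orbit_iff.mpr ⟨⟨γ, h⟩, rfl⟩))

/-- (Ported verbatim from the HodgeCMPerL package; no docstring in the source.) -/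
theorem subgroupOf_le_ker_deckHom (hle : Γ₁ ≤ Γ) [(Γ₁.subgroupOf Γ).Normal] :
    Γ₁.subgroupOf Γ ≤ (deckHom Γ₁ Γ hle (X := X)).ker := fun γ hγ =>
  (MonoidHom.mem_ker).mpr (deckHom_eq_one_of_mem Γ₁ Γ hle γ (Subgroup.mem_subgroupOf.mp hγ))

/-- **The deck group is finite** when `[Γ : Γ₁] < ∞`. -/
theorem finite_range_deckHom (hle : Γ₁ ≤ Γ) [(Γ₁.subgroupOf Γ).Normal] [(Γ₁.subgroupOf Γ).FiniteIndex] :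
    Finite (deckHom Γ₁ Γ hle (X := X)).range := by
  haveI : (deckHom Γ₁ Γ hle (X := X)).ker.FiniteIndex :=
    Subgroup.finiteIndex_of_le (subgroupOf_le_ker_deckHom Γ₁ Γ hle)
  exact Finite.of_equiv _ (QuotientGroup.quotientKerEquivRange (deckHom Γ₁ Γ hle (X := X))).toEquiv

/-- The order of the deck group divides `[Γ : Γ₁]`. -/
theorem natCard_range_deckHom_dvd (hle : Γ₁ ≤ Γ) [(Γ₁.subgroupOf Γ).Normal] :
    Nat.card (deckHom Γ₁ Γ hle (X := X)).range ∣ Γ₁.relIndex Γ := by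
  rw [← Subgroup.index_ker, Subgroup.relIndex]
  exact Subgroup.index_dvd_of_le (subgroupOf_le_ker_deckHom Γ₁ Γ hle)

/-- (Ported verbatim from the HodgeCMPerL package; no docstring in the source.) -/
theorem orbitMap_deckHom (hle : Γ₁ ≤ Γ) [(Γ₁.subgroupOf Γ).Normal] (γ : Γ) (q : orbitRel.Quotient Γ₁ X) :
    orbitMap Γ₁ Γ hle (deckHom Γ₁ Γ hle γ q) = orbitMap Γ₁ Γ hle q := by
  induction q using Quotient.inductionOn with
  | h x =>
    rw [deckHom_mk, orbitMap_mk, orbitMap_mk]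
    exact Quotient.sound (orbitRel_apply.mpr (mem_orbit_iff.mpr ⟨γ, rfl⟩))

/-- **Fibres of the orbit map are deck orbits.** -/
theorem orbitMap_eq_iff (hle : Γ₁ ≤ Γ) [(Γ₁.subgroupOf Γ).Normal] (p q : orbitRel.Quotient Γ₁ X) :
    orbitMap Γ₁ Γ hle p = orbitMap Γ₁ Γ hle q ↔ ∃ γ : Γ, deckHom Γ₁ Γ hle γ q = p := by
  constructor
  · induction p using Quotient.inductionOn with
    | h x =>
      induction q using Quotient.inductionOn with
      | h y =>
        intro h
        rw [orbitMap_mk, orbitMap_mk] at h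
        obtain ⟨γ, hγ⟩ := mem_orbit_iff.mp (orbitRel_apply.mp (Quotient.exact h))
        exact ⟨γ, by rw [deckHom_mk, ← Subgroup.smul_def, hγ]⟩
  · rintro ⟨γ, rfl⟩
    exact orbitMap_deckHom Γ₁ Γ hle γ q

/-- The orbit map descended to the orbit space of the deck group. -/
def stagesMap (hle : Γ₁ ≤ Γ) [(Γ₁.subgroupOf Γ).Normal] :
    orbitRel.Quotient (deckHom Γ₁ Γ hle (X := X)).range (orbitRel.Quotient Γ₁ X) → orbitRel.Quotient Γ X :=
  Quotient.lift (orbitMap Γ₁ Γ hle) (by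
    intro p q hpq
    obtain ⟨⟨d, hd⟩, rfl⟩ := mem_orbit_iff.mp (orbitRel_apply.mp hpq)
    obtain ⟨γ, rfl⟩ := MonoidHom.mem_range.mp hd
    rw [Subgroup.mk_smul, Equiv.Perm.smul_def]
    exact orbitMap_deckHom Γ₁ Γ hle γ q)

/-- (Ported verbatim from the HodgeCMPerL package; no docstring in the source.) -/
@[simp] theorem stagesMap_mk (hle : Γ₁ ≤ Γ) [(Γ₁.subgroupOf Γ).Normal] (q : orbitRel.Quotient Γ₁ X) :
    stagesMap Γ₁ Γ hle (Quotient.mk (orbitRel _ _) q) = orbitMap Γ₁ Γ hle q := rfl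

/-- (Ported verbatim from the HodgeCMPerL package; no docstring in the source.) -/
theorem stagesMap_surjective (hle : Γ₁ ≤ Γ) [(Γ₁.subgroupOf Γ).Normal] :
    Function.Surjective (stagesMap Γ₁ Γ hle (X := X)) := by
  intro r
  obtain ⟨q, rfl⟩ := orbitMap_surjective Γ₁ Γ hle r
  exact ⟨Quotient.mk (orbitRel _ _) q, rfl⟩

/-- (Ported verbatim from the HodgeCMPerL package; no docstring in the source.) -/
theorem stagesMap_injective (hle : Γ₁ ≤ Γ) [(Γ₁.subgroupOf Γ).Normal] :
    Function.Injective (stagesMap Γ₁ Γ hle (X := X)) := by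
  intro a b
  induction a using Quotient.inductionOn with
  | h p =>
    induction b using Quotient.inductionOn with
    | h q =>
      intro h
      change orbitMap Γ₁ Γ hle p = orbitMap Γ₁ Γ hle q at h
      obtain ⟨γ, rfl⟩ := (orbitMap_eq_iff Γ₁ Γ hle p q).mp h
      refine Quotient.sound (orbitRel_apply.mpr (mem_orbit_iff.mpr ?_))
      exact ⟨⟨deckHom Γ₁ Γ hle γ, MonoidHom.mem_range.mpr ⟨γ, rfl⟩⟩, by
        rw [Subgroup.mk_smul, Equiv.Perm.smul_def]⟩

/-- **Orbit spaces in stages (set level): `(X/Γ₁)/D ≃ X/Γ`**, `D` = the deck group of `Γ ⊵ Γ₁`. -/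
def stagesEquiv (hle : Γ₁ ≤ Γ) [(Γ₁.subgroupOf Γ).Normal] :
    orbitRel.Quotient (deckHom Γ₁ Γ hle (X := X)).range (orbitRel.Quotient Γ₁ X) ≃ orbitRel.Quotient Γ X :=
  Equiv.ofBijective (stagesMap Γ₁ Γ hle) ⟨stagesMap_injective Γ₁ Γ hle, stagesMap_surjective Γ₁ Γ hle⟩

/-- (Ported verbatim from the HodgeCMPerL package; no docstring in the source.) -/
@[simp] theorem stagesEquiv_apply (hle : Γ₁ ≤ Γ) [(Γ₁.subgroupOf Γ).Normal]
    (a : orbitRel.Quotient (deckHom Γ₁ Γ hle (X := X)).range (orbitRel.Quotient Γ₁ X)) :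
    stagesEquiv Γ₁ Γ hle a = stagesMap Γ₁ Γ hle a := rfl

/-! ### Free actions -/

/-- If `Γ` meets the isotropy group of `x` trivially and `γ • x` lies in the `Γ₁`-orbit of `x`, then
`γ ∈ Γ₁`. -/
theorem mem_of_smul_mem_orbit (hle : Γ₁ ≤ Γ) {x : X} (hfree : stabilizer G x ⊓ Γ = ⊥) {γ : G} (hγ : γ ∈ Γ)
    (h : γ • x ∈ orbit Γ₁ x) : γ ∈ Γ₁ := by
  obtain ⟨δ, hδ⟩ := mem_orbit_iff.mp h
  rw [Subgroup.smul_def] at hδ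
  have hmem : (δ : G)⁻¹ * γ ∈ stabilizer G x ⊓ Γ := by
    refine Subgroup.mem_inf.mpr ⟨mem_stabilizer_iff.mpr ?_, Γ.mul_mem (Γ.inv_mem (hle δ.2)) hγ⟩
    rw [mul_smul, ← hδ, inv_smul_smul]
  rw [hfree, Subgroup.mem_bot] at hmem
  have : γ = δ := by
    calc γ = (δ : G) * ((δ : G)⁻¹ * γ) := by group
      _ = δ := by rw [hmem, mul_one]
  rw [this]
  exact δ.2

/-- **The deck group acts freely on `X/Γ₁` when `Γ` acts freely on `X`.** -/
theorem stabilizer_deck_eq_bot (hle : Γ₁ ≤ Γ) [(Γ₁.subgroupOf Γ).Normal]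
    (hfree : ∀ x : X, stabilizer G x ⊓ Γ = ⊥) (q : orbitRel.Quotient Γ₁ X) :
    stabilizer (deckHom Γ₁ Γ hle (X := X)).range q = ⊥ := by
  rw [Subgroup.eq_bot_iff_forall]
  rintro ⟨d, hd⟩ hdq
  obtain ⟨γ, rfl⟩ := MonoidHom.mem_range.mp hd
  induction q using Quotient.inductionOn with
  | h x =>
    rw [mem_stabilizer_iff, Subgroup.mk_smul, Equiv.Perm.smul_def, deckHom_mk] at hdq
    have hγ : (γ : G) ∈ Γ₁ :=
      mem_of_smul_mem_orbit Γ₁ Γ hle (hfree x) γ.2 (orbitRel_apply.mp (Quotient.exact hdq))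
    exact Subtype.ext (deckHom_eq_one_of_mem Γ₁ Γ hle γ hγ)

/-- Element form of freeness: `deckHom γ q = q ↔ γ ∈ Γ₁`, for `Γ` acting freely. -/
theorem deckHom_apply_eq_self_iff (hle : Γ₁ ≤ Γ) [(Γ₁.subgroupOf Γ).Normal]
    (hfree : ∀ x : X, stabilizer G x ⊓ Γ = ⊥) (γ : Γ) (q : orbitRel.Quotient Γ₁ X) :
    deckHom Γ₁ Γ hle γ q = q ↔ (γ : G) ∈ Γ₁ := by
  constructor
  · intro h
    induction q using Quotient.inductionOn with
    | h x =>
      rw [deckHom_mk] at h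
      exact mem_of_smul_mem_orbit Γ₁ Γ hle (hfree x) γ.2 (orbitRel_apply.mp (Quotient.exact h))
  · intro h
    rw [deckHom_eq_one_of_mem Γ₁ Γ hle γ h, Equiv.Perm.coe_one, id]

/-- With one free point the kernel of the deck homomorphism is exactly `Γ₁`. -/
theorem ker_deckHom_eq (hle : Γ₁ ≤ Γ) [(Γ₁.subgroupOf Γ).Normal] {x : X} (hfree : stabilizer G x ⊓ Γ = ⊥) :
    (deckHom Γ₁ Γ hle (X := X)).ker = Γ₁.subgroupOf Γ := by
  refine le_antisymm ?_ (subgroupOf_le_ker_deckHom Γ₁ Γ hle)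
  intro γ hγ
  rw [MonoidHom.mem_ker] at hγ
  have h := congrArg (fun e : Equiv.Perm (orbitRel.Quotient Γ₁ X) => e (Quotient.mk (orbitRel Γ₁ X) x)) hγ
  simp only [deckHom_mk, Equiv.Perm.coe_one, id] at h
  exact Subgroup.mem_subgroupOf.mpr (mem_of_smul_mem_orbit Γ₁ Γ hle hfree γ.2 (orbitRel_apply.mp (Quotient.exact h)))

/-- With one free point: **`D ≃* Γ/Γ₁`** and `|D| = [Γ : Γ₁]`. -/
def quotientEquivRangeDeckHom (hle : Γ₁ ≤ Γ) [(Γ₁.subgroupOf Γ).Normal] {x : X}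
    (hfree : stabilizer G x ⊓ Γ = ⊥) :
    Γ ⧸ Γ₁.subgroupOf Γ ≃* (deckHom Γ₁ Γ hle (X := X)).range :=
  (QuotientGroup.quotientMulEquivOfEq (ker_deckHom_eq Γ₁ Γ hle hfree).symm).trans
    (QuotientGroup.quotientKerEquivRange _)

/-- (Ported verbatim from the HodgeCMPerL package; no docstring in the source.) -/
theorem natCard_range_deckHom_eq (hle : Γ₁ ≤ Γ) [(Γ₁.subgroupOf Γ).Normal] {x : X}
    (hfree : stabilizer G x ⊓ Γ = ⊥) :
    Nat.card (deckHom Γ₁ Γ hle (X := X)).range = Γ₁.relIndex Γ := by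
  rw [← Subgroup.index_ker, ker_deckHom_eq Γ₁ Γ hle hfree, Subgroup.relIndex]

end Abstract

/-! ## §2  Topology: `(X/Γ₁)/D ≃ₜ X/Γ` -/

section Topology

variable {G X : Type*} [Group G] [MulAction G X] [TopologicalSpace X] (Γ₁ Γ : Subgroup G)

/-- (Ported verbatim from the HodgeCMPerL package; no docstring in the source.) -/
theorem continuous_orbitMap (hle : Γ₁ ≤ Γ) : Continuous (orbitMap Γ₁ Γ hle (X := X)) :=
  Continuous.quotient_lift continuous_quotient_mk' _

omit [TopologicalSpace X] in
/-- (Ported verbatim from the HodgeCMPerL package; no docstring in the source.) -/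
theorem orbitMap_comp_mk (hle : Γ₁ ≤ Γ) :
    orbitMap Γ₁ Γ hle ∘ (Quotient.mk (orbitRel Γ₁ X)) = Quotient.mk (orbitRel Γ X) := rfl

/-- The orbit map `X/Γ₁ → X/Γ` is a quotient map (for ANY action, no continuity needed). -/
theorem isQuotientMap_orbitMap (hle : Γ₁ ≤ Γ) : IsQuotientMap (orbitMap Γ₁ Γ hle (X := X)) := by
  refine IsQuotientMap.of_comp (f := Quotient.mk (orbitRel Γ₁ X)) continuous_quotient_mk'
    (continuous_orbitMap Γ₁ Γ hle) ?_
  rw [orbitMap_comp_mk]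
  exact isQuotientMap_quotient_mk'

/-- (Ported verbatim from the HodgeCMPerL package; no docstring in the source.) -/
theorem continuous_stagesMap (hle : Γ₁ ≤ Γ) [(Γ₁.subgroupOf Γ).Normal] :
    Continuous (stagesMap Γ₁ Γ hle (X := X)) :=
  Continuous.quotient_lift (continuous_orbitMap Γ₁ Γ hle) _

/-- (Ported verbatim from the HodgeCMPerL package; no docstring in the source.) -/
theorem isQuotientMap_stagesMap (hle : Γ₁ ≤ Γ) [(Γ₁.subgroupOf Γ).Normal] :
    IsQuotientMap (stagesMap Γ₁ Γ hle (X := X)) :=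
  IsQuotientMap.of_comp continuous_quotient_mk' (continuous_stagesMap Γ₁ Γ hle)
    (by
      change IsQuotientMap (orbitMap Γ₁ Γ hle (X := X))
      exact isQuotientMap_orbitMap Γ₁ Γ hle)

/-- (Ported verbatim from the HodgeCMPerL package; no docstring in the source.) -/
theorem isHomeomorph_stagesMap (hle : Γ₁ ≤ Γ) [(Γ₁.subgroupOf Γ).Normal] :
    IsHomeomorph (stagesMap Γ₁ Γ hle (X := X)) :=
  isHomeomorph_iff_isQuotientMap_injective.mpr
    ⟨isQuotientMap_stagesMap Γ₁ Γ hle, stagesMap_injective Γ₁ Γ hle⟩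

/-- **Orbit spaces in stages (topological): `(X/Γ₁)/D ≃ₜ X/Γ`** — for ANY action of `G` on a topological
space `X` (all orbit spaces with the quotient topology; no continuity of the action is needed). -/
def stagesHomeomorph (hle : Γ₁ ≤ Γ) [(Γ₁.subgroupOf Γ).Normal] :
    orbitRel.Quotient (deckHom Γ₁ Γ hle (X := X)).range (orbitRel.Quotient Γ₁ X) ≃ₜ orbitRel.Quotient Γ X :=
  (isHomeomorph_stagesMap Γ₁ Γ hle).homeomorph

/-- (Ported verbatim from the HodgeCMPerL package; no docstring in the source.) -/
@[simp] theorem stagesHomeomorph_apply (hle : Γ₁ ≤ Γ) [(Γ₁.subgroupOf Γ).Normal]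
    (a : orbitRel.Quotient (deckHom Γ₁ Γ hle (X := X)).range (orbitRel.Quotient Γ₁ X)) :
    stagesHomeomorph Γ₁ Γ hle a = stagesMap Γ₁ Γ hle a := by
  simp [stagesHomeomorph]

variable [ContinuousConstSMul G X]

/-- (Ported verbatim from the HodgeCMPerL package; no docstring in the source.) -/
theorem continuous_deckFun (g : G) (hg : ∀ δ ∈ Γ₁, g * δ * g⁻¹ ∈ Γ₁) :
    Continuous (deckFun Γ₁ g hg (X := X)) :=
  Continuous.quotient_lift (continuous_quotient_mk'.comp (continuous_const_smul g)) _

/-- Deck transformations are continuous (when `G` acts by homeomorphisms). -/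
theorem continuous_deckHom (hle : Γ₁ ≤ Γ) [(Γ₁.subgroupOf Γ).Normal] (γ : Γ) :
    Continuous (deckHom Γ₁ Γ hle (X := X) γ) :=
  continuous_deckFun Γ₁ (γ : G) (fun _ hδ => conj_mem_of_normal_subgroupOf hle γ.2 hδ)

/-- The deck group acts on `X/Γ₁` by homeomorphisms. -/
instance continuousConstSMul_range_deckHom (hle : Γ₁ ≤ Γ) [(Γ₁.subgroupOf Γ).Normal] :
    ContinuousConstSMul (deckHom Γ₁ Γ hle (X := X)).range (orbitRel.Quotient Γ₁ X) where
  continuous_const_smul d := by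
    obtain ⟨d, hd⟩ := d
    obtain ⟨γ, rfl⟩ := MonoidHom.mem_range.mp hd
    change Continuous fun q : orbitRel.Quotient Γ₁ X => deckHom Γ₁ Γ hle γ q
    exact continuous_deckHom Γ₁ Γ hle γ

/-- The deck transformation as a homeomorphism of `X/Γ₁`. -/
def deckHomeomorph (hle : Γ₁ ≤ Γ) [(Γ₁.subgroupOf Γ).Normal] (γ : Γ) :
    orbitRel.Quotient Γ₁ X ≃ₜ orbitRel.Quotient Γ₁ X where
  toEquiv := deckHom Γ₁ Γ hle γ
  continuous_toFun := continuous_deckHom Γ₁ Γ hle γ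
  continuous_invFun := by
    have h : Continuous (deckHom Γ₁ Γ hle (X := X) γ⁻¹) := continuous_deckHom Γ₁ Γ hle γ⁻¹
    rw [map_inv] at h
    exact h

/-- (Ported verbatim from the HodgeCMPerL package; no docstring in the source.) -/
@[simp] theorem deckHomeomorph_apply (hle : Γ₁ ≤ Γ) [(Γ₁.subgroupOf Γ).Normal] (γ : Γ)
    (q : orbitRel.Quotient Γ₁ X) : deckHomeomorph Γ₁ Γ hle γ q = deckHom Γ₁ Γ hle γ q := rfl

end Topology

end Stages

end HodgeCM.PerL34.Godement

/-! ## §3  PerL v5 l. 75 for the pieces of `G_U` on `G_U(ℝ)/C` -/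

namespace HodgeCM.PerL34.Godement

open HodgeCM.PerL34.Godement.Stages
open HodgeCM.Adelic HodgeCM.PerL34.AdelicUnitaryFactorisation

section PerLPieces

variable (L : CMField) {m : ℕ} (H : Matrix (Fin m) (Fin m) L) (C : Subgroup (Uinf L H))
  (K₁ Kf : Subgroup (Ufin L H)) (g : Ufin L H)


-- port_pkg: scope closed for this part
end PerLPieces
end HodgeCM.PerL34.Godement
end
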